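import Mathlib
import Summits.Ventures.PercRepro2.Defs
import Summits.Ventures.PercRepro2.Independence
import Summits.Ventures.PercRepro2.Graph
import Summits.Ventures.PercRepro2.Exploration
import Summits.Ventures.PercRepro2.Induced
import Summits.Ventures.PercRepro2.HubModel
import Summits.Ventures.PercRepro2.HubLaw
import Summits.Ventures.PercRepro2.HubRootLaw

/-!
# Computable five-mark connectivity and hub events
(blind cell PercRepro2, typer-1 g8; MINE2-HUB.md §2 (a)–(b), §5 (i))

* `reachOf w π u v : Bool` — reachability in the model graph `modelGraphOf w π` computed by four
  closure steps (`reachSet`; five marks, so a path has length `≤ 4`); `reachOf_iff` identifies it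
  with `(modelGraphOf w π).Reachable u v`.  Truth tables over the `2^7 · 2^3` state pairs are
  therefore kernel-computable (`decide`), with no walk enumeration.
* `toEvent ends μ Ψ = {ω | Ψ (W ω) (Π ω) = true}` — the event of a **hub event** `Ψ : HubEvt`
  (a Boolean function of the state pair); closed under `∩`, `∪`, complement (`toEvent_and`,
  `toEvent_or`, `toEvent_not`), and every connection event between marks is one
  (`connEvent_eq_toEvent`, in the class R).
* `prob_toEvent` — the hub law for hub events:
  `P(toEvent Ψ) = Σ_π P_q{w | Ψ w π} · m_π`, `q = bundleProb`, `m_π = P(Π = π)`.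
-/

namespace Summit.Ventures.PercRepro2.Hub

section Reach

variable (w : Fin 7 → Bool) (π : Fin 3 → Bool)

/-- The adjacency table is symmetric. -/
lemma adjOf_comm (u v : Mark) : adjOf w π u v = adjOf w π v u := by
  cases u <;> cases v <;> rfl

/-- The adjacency table vanishes on the diagonal. -/
lemma adjOf_self (u : Mark) : adjOf w π u u = false := by
  cases u <;> rfl

/-- Adjacent marks in the table are distinct. -/
lemma ne_of_adjOf {u v : Mark} (h : adjOf w π u v = true) : u ≠ v := by
  rintro rfl
  rw [adjOf_self] at h
  exact Bool.false_ne_true h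

/-- The table gives the model-graph adjacency. -/
lemma modelGraphOf_adj_iff {u v : Mark} :
    (modelGraphOf w π).Adj u v ↔ adjOf w π u v = true := by
  rw [modelGraphOf, SimpleGraph.fromRel_adj, adjOf_comm w π v u, or_self]
  exact ⟨fun h => h.2, fun h => ⟨ne_of_adjOf w π h, h⟩⟩

/-- One closure step: add the model-neighbours of `S`. -/
def stepOf (S : Finset Mark) : Finset Mark :=
  S ∪ Finset.univ.filter fun v => ∃ u ∈ S, adjOf w π u v = true

/-- The marks reached from `u` in at most `n` steps. -/
def reachSet (u : Mark) : ℕ → Finset Mark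
  | 0 => {u}
  | n + 1 => stepOf w π (reachSet u n)

/-- **Computable reachability** in the model graph of a state pair: four closure steps suffice
for five marks. -/
def reachOf (u v : Mark) : Bool := decide (v ∈ reachSet w π u 4)

/-- The closure steps are increasing. -/
lemma reachSet_subset_succ (u : Mark) (n : ℕ) : reachSet w π u n ⊆ reachSet w π u (n + 1) :=
  Finset.subset_union_left

/-- The closure steps are increasing (general form). -/
lemma reachSet_subset_of_le (u : Mark) {n m : ℕ} (h : n ≤ m) :
    reachSet w π u n ⊆ reachSet w π u m := by
  induction h with
  | refl => exact subset_rfl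
  | step _ ih => exact ih.trans (reachSet_subset_succ w π u _)

/-- A neighbour of a reached mark is reached one step later. -/
lemma mem_reachSet_succ_of_adj {u x y : Mark} {n : ℕ} (hx : x ∈ reachSet w π u n)
    (hxy : adjOf w π x y = true) : y ∈ reachSet w π u (n + 1) := by
  refine Finset.mem_union_right _ ?_
  rw [Finset.mem_filter]
  exact ⟨Finset.mem_univ _, x, hx, hxy⟩

/-- Soundness: a reached mark is reachable in the model graph. -/
lemma reachable_of_mem_reachSet {u v : Mark} : ∀ {n : ℕ}, v ∈ reachSet w π u n →
    (modelGraphOf w π).Reachable u v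
  | 0, h => by
    rw [reachSet, Finset.mem_singleton] at h
    subst h
    exact SimpleGraph.Reachable.refl _
  | n + 1, h => by
    rw [reachSet, stepOf, Finset.mem_union, Finset.mem_filter] at h
    rcases h with h | ⟨_, x, hx, hxv⟩
    · exact reachable_of_mem_reachSet h
    · exact (reachable_of_mem_reachSet hx).trans
        ((modelGraphOf_adj_iff w π).2 hxv).reachable

/-- Completeness along a walk: a walk of length `l` from a reached mark ends in a mark reached
`l` steps later. -/
lemma mem_reachSet_add_length {u x v : Mark} (p : (modelGraphOf w π).Walk x v) :
    ∀ {n : ℕ}, x ∈ reachSet w π u n → v ∈ reachSet w π u (n + p.length) := by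
  induction p with
  | nil => intro n hx; simpa using hx
  | cons hadj _ ih =>
    intro n hx
    have := ih (mem_reachSet_succ_of_adj w π hx ((modelGraphOf_adj_iff w π).1 hadj))
    rw [SimpleGraph.Walk.length_cons, ← Nat.add_assoc]
    rwa [Nat.add_right_comm] at this

/-- The five marks. -/
lemma card_mark : Fintype.card Mark = 5 := by decide

/-- **Computable reachability is reachability**: `reachOf w π u v = true ↔ u` reaches `v` in the
model graph. -/
theorem reachOf_iff (u v : Mark) : reachOf w π u v = true ↔ (modelGraphOf w π).Reachable u v := by
  rw [reachOf, decide_eq_true_iff]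
  refine ⟨reachable_of_mem_reachSet w π, fun h => ?_⟩
  refine h.elim_path fun p => ?_
  have hlen : p.1.length ≤ 4 := by
    have := p.2.length_lt
    rw [card_mark] at this
    omega
  have hmem : v ∈ reachSet w π u (0 + p.1.length) :=
    mem_reachSet_add_length w π p.1 (by simp [reachSet])
  exact reachSet_subset_of_le w π u (by omega) hmem

end Reach

/-- A hub event: a Boolean function of the state pair `(w, π)`. -/
abbrev HubEvt := (Fin 7 → Bool) → (Fin 3 → Bool) → Bool

variable {V : Type*} {E : Type*}

section Events

variable (ends : E → Sym2 V) (μ : Mark → V)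

/-- The event of `ω` determined by a hub event: `{ω | Ψ (W ω) (Π ω)}`. -/
def toEvent (Ψ : HubEvt) : Set (Config E) :=
  {ω | Ψ (rootState ends μ ω) (innerPat ends μ ω) = true}

/-- Membership in `toEvent`. -/
lemma mem_toEvent {Ψ : HubEvt} {ω : Config E} :
    ω ∈ toEvent ends μ Ψ ↔ Ψ (rootState ends μ ω) (innerPat ends μ ω) = true := Iff.rfl

/-- Conjunction of hub events is intersection. -/
lemma toEvent_and (Ψ₁ Ψ₂ : HubEvt) :
    toEvent ends μ (fun w π => Ψ₁ w π && Ψ₂ w π) = toEvent ends μ Ψ₁ ∩ toEvent ends μ Ψ₂ := by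
  ext ω
  simp only [mem_toEvent, Set.mem_inter_iff, Bool.and_eq_true]

/-- Disjunction of hub events is union. -/
lemma toEvent_or (Ψ₁ Ψ₂ : HubEvt) :
    toEvent ends μ (fun w π => Ψ₁ w π || Ψ₂ w π) = toEvent ends μ Ψ₁ ∪ toEvent ends μ Ψ₂ := by
  ext ω
  simp only [mem_toEvent, Set.mem_union, Bool.or_eq_true]

/-- Negation of a hub event is the complement. -/
lemma toEvent_not (Ψ : HubEvt) :
    toEvent ends μ (fun w π => !Ψ w π) = (toEvent ends μ Ψ)ᶜ := by
  ext ω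
  simp only [mem_toEvent, Set.mem_compl_iff, Bool.not_eq_true', Bool.not_eq_true]

/-- The constant hub event `true` is everything. -/
lemma toEvent_true : toEvent ends μ (fun _ _ => true) = Set.univ := by
  ext ω
  simp [mem_toEvent]

variable {ends μ}

/-- **Connection events between marks are hub events** (class R, injective marking). -/
theorem connEvent_eq_toEvent (hinj : Function.Injective μ) (hR : ClassR ends μ) (u v : Mark) :
    connEvent ends (μ u) (μ v) = toEvent ends μ (fun w π => reachOf w π u v) := by
  ext ω
  rw [mem_connEvent, mem_toEvent, reachOf_iff, conn_iff_reachable_state hinj hR]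

/-- **The hub law for hub events**: `P(toEvent Ψ) = Σ_π P_q{w | Ψ w π} · P(Π = π)`. -/
theorem prob_toEvent [Fintype E] [DecidableEq E] [DecidableEq V] {R : Type*} [CommRing R]
    (hinj : Function.Injective μ) (p : E → R) (Ψ : HubEvt) :
    prob p (toEvent ends μ Ψ) =
      ∑ π, prob (bundleProb ends μ p) {w | Ψ w π = true} * prob p {ω | innerPat ends μ ω = π} :=
  prob_hubEvent_eq ends μ hinj p (fun w π => Ψ w π = true)

end Events

end Summit.Ventures.PercRepro2.Hub
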